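import Summits.HodgeConjecture.CorCM.MultiFieldWeilEqualPrimes
import Summits.HodgeConjecture.CorCM.MultiFieldWeilMarkmanIntrinsic
import HarnessLib

/-!
# MULTI-FIELD WEIL ENGINE — MARKMAN TOWERS: ANY NUMBER of `(1,2)`-threefolds over SEXTIC CM fields and `(2,3)`-fivefolds over DECIC CM fields sharing `k`, the
# fields of each degree ORDERED so that each is moved by an automorphism of `ℂ` fixing its predecessors — the Hodge conjecture for every product of copies of
# `E, T_1, …, T_a, B_1, …, B_b` GIVEN ONLY Markman's fourfold and hyperbolic-sixfold theorems

Cell `pub-hodgecm2` (COR-CM), seat b30 gen 30 (2026-08-24); count-neutral own lane MULTI-FIELD WEIL ENGINE (stem `MultiFieldWeil*`), the first consumers of the ORDERED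
PRIME TOWER (`CorCM/MultiFieldWeilEqualPrimes.lean`) and of the INTRINSIC Markman suppliers (`CorCM/MultiFieldWeilMarkmanIntrinsic.lean`): towers all of whose slots are
covered by Markman's theorems (prime relative degrees `3` and `5`, `k`-signatures `(1,2)` and `(2,3)`).  Theorems only; no definition, no named fact of its own, no
`sorry`, no frames, no position sets.  HONEST FRAMING: CONDITIONAL on the displayed named facts `Markman2025_weilClasses_algebraic_abelianFourfold` (sextic slots) and
`Markman2025_weilClasses_algebraic_hyperbolicSixfold` (decic slots) — and on NOTHING ELSE: no open Weil space enters.  `HC_CM` is NOT proved and not asserted.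

* §1 **`hodgeConjectureFor_biproduct_comp_of_sexticTower`** — `E ⊨ (k; {τ})` and `T_m ⊨ (K_m; Φ_m)`, `m < r`, over SEXTIC CM fields `K_m ⊇ i_m(k)` (`[K_m : ℚ] = 6`) with
  ONE member of `Φ_m` over `τ`, such that for every `m ≥ 1` some automorphism of `ℂ` over `τ(k)` FIXES every `τ`-embedding of `K_0, …, K_{m−1}` and MOVES one of `K_m`
  (e.g. `K_m` not contained in the compositum of the Galois closures of its predecessors over `k`; for `r = 2`: `K_1 ≇ K_0` suffices, the cubic subextensions of the
  Galois closure of `K_0 / k` being the conjugates of `K_0`): the Hodge conjecture for EVERY product of copies `⨁_j A(κ j)` of `E, T_0, …, T_{r−1}` GIVEN ONLY Markman's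
  fourfold theorem.  `r = 2` is gen 16ʼs TWO-FIELD-PAIR by the engine; `r ≥ 3` is NEW.
* §2 **`hodgeConjectureFor_biproduct_comp_of_decicTower`** — the same over DECIC CM fields with TWO members over `τ` (`(2,3)`-fivefolds), GIVEN ONLY Markman's
  hyperbolic-sixfold theorem.
* §3 **`hodgeConjectureFor_biproduct_comp_of_sexticDecicTower`** — both at once (sizes `3 < 5`, any priority refining the sizes, the automorphism hypothesis within each
  degree), GIVEN Markman's two theorems; `…of_avDominatedBy…` for everything dominated.
The hypothesis is NOT idle: three sextic fields `k(∛a), k(∛b), k(∛(ab))` over `k = ℚ(√−3)` violate it for the third field, and there the product `T_0 × T_1 × T_2` carries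
Hodge classes outside the span the engine produces.
[cite: Markman2025SurveySecant, Thm. 1.2] [cite: Markman2025SecantWeil, Thm 1.5.1] [cite: Pohlmann1968, Thm 1] [cite: MoonenZarhin1995Duke, Thm. 2.4]
[cite: DixonMortimer1996, §1.6 and Thm. 1.6A] [cite: MumfordAV1970, §19]

## References
* [Markman2025SurveySecant] E. Markman, arXiv:2509.23403, Thm. 1.2.  [Markman2025SecantWeil] E. Markman, Cycles on abelian 2n-folds of Weil type from secant sheaves on
  abelian n-folds, Thm 1.5.1.  [Pohlmann1968] H. Pohlmann, Ann. of Math. 88 (1968), Thm 1.  [MoonenZarhin1995Duke] B. Moonen, Yu. Zarhin, Duke Math. J. 77 (1995),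
  Thm. 2.4.  [DixonMortimer1996] J. D. Dixon, B. Mortimer, *Permutation Groups*, GTM 163, §1.6, Thm. 1.6A.  [MumfordAV1970] D. Mumford, *Abelian Varieties*, §19.
-/

noncomputable section

open CategoryTheory CategoryTheory.Limits NumberField

namespace Summit.HodgeConjecture.CorCM.MultiFieldWeil

open Finset
open Literature.AlgebraicGeometry Literature.AlgebraicGeometry.Motives Literature.AlgebraicGeometry.HodgeTheory
open Literature.AlgebraicGeometry.ComplexMultiplication (IsCMTypeRealisation)
open Literature.AlgebraicTopology.SingularHomology
open Literature.NumberTheory.ComplexMultiplication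

open scoped Classical

variable {I : Type} {r : ℕ} {Kf : I → Type} [∀ i, Field (Kf i)] [∀ i, NumberField (Kf i)] [∀ i, IsCMField (Kf i)]
  {i₀ : I} {is : Fin r → I} {τ : Kf i₀ →+* ℂ}
  {A : Fin (r + 1) → AbelianVariety ℂ} {Φ : ∀ j : Fin (r + 1), CMType (Kf (mfSlots i₀ is j))}
  {ι : ∀ j, 𝓞 (Kf (mfSlots i₀ is j)) →+* End (A j)}
  {θ : ∀ j, Kf (mfSlots i₀ is j) →+* Module.End ℂ (complexBetti (A j).X 1)}

/-! ## §3 first: sextic and decic fields together -/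

/-- **HEADLINE — ANY NUMBER OF SEXTIC `(1,2)` AND DECIC `(2,3)` CM FIELDS SHARING `k`, GIVEN ONLY MARKMAN'S TWO THEOREMS.**  `k = Kf i₀` imaginary quadratic,
`E = A 0 ⊨ (k; {τ})`, `B_m = A (m+1) ⊨ (K_m; Φ (m+1))` with `[K_m : ℚ] = 2 n_m`, `(n_m, p_m) ∈ {(3, 1), (5, 2)}` (`p_m` = members of `Φ (m+1)` over `τ`), a priority
`prio` (injective, refining the sizes) such that every `K_m` having an equal-degree predecessor is MOVED by an automorphism of `ℂ` over `τ(k)` FIXING all `τ`-embeddings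
of its equal-degree predecessors (`hH`).  Then the Hodge conjecture holds for EVERY product of copies `⨁_j A(κ j)`.  The single-slot Weil spaces are Markman's fourfold
(`T × E`) and hyperbolic-sixfold (`B × E`) theorems, supplied intrinsically; nothing else is assumed.  `HC_CM` is NOT asserted. [cite: Markman2025SurveySecant, Thm. 1.2]
[cite: Markman2025SecantWeil, Thm 1.5.1] [cite: Pohlmann1968, Thm 1] [cite: MoonenZarhin1995Duke, Thm. 2.4] [cite: DixonMortimer1996, §1.6 and Thm. 1.6A] -/
theorem hodgeConjectureFor_biproduct_comp_of_sexticDecicTower (hW4 : Markman2025_weilClasses_algebraic_abelianFourfold)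
    (hM6 : Markman2025_weilClasses_algebraic_hyperbolicSixfold) (n p prio : Fin r → ℕ)
    (hnp : ∀ m, (n m = 3 ∧ p m = 1) ∨ (n m = 5 ∧ p m = 2)) (hinj : Function.Injective prio) (hmono : ∀ m m', n m < n m' → prio m < prio m')
    {N : ℕ} (κ : Fin N → Fin (r + 1)) (h2 : Module.finrank ℚ (Kf i₀) = 2) (hdeg : ∀ m : Fin r, Module.finrank ℚ (Kf (is m)) = 2 * n m)
    (im : ∀ m : Fin r, Kf i₀ →+* Kf (is m)) (hA : ∀ j, IsCMTypeRealisation (Φ j) (A j) (ι j) (θ j)) (hΨ : ∀ σ : Kf i₀ →+* ℂ, σ ∈ (Φ 0).1 ↔ σ = τ)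
    (hp : ∀ m : Fin r, (Finset.univ.filter fun s : Kf (is m) →+* ℂ => s.comp (im m) = τ ∧ s ∈ (Φ m.succ).1).card = p m)
    (hH : ∀ m₀ : Fin r, (∃ m, m ≠ m₀ ∧ n m = n m₀ ∧ prio m < prio m₀) →
      ∃ ρ : ℂ ≃+* ℂ, (ρ : ℂ →+* ℂ).comp τ = τ ∧
        (∀ m, n m = n m₀ → prio m < prio m₀ → ∀ s : Kf (is m) →+* ℂ, s.comp (im m) = τ → (ρ : ℂ →+* ℂ).comp s = s) ∧
        ∃ s : Kf (is m₀) →+* ℂ, s.comp (im m₀) = τ ∧ (ρ : ℂ →+* ℂ).comp s ≠ s) :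
    HodgeConjectureFor (⨁ fun j => A (κ j)).dim (⨁ fun j => A (κ j)).X := by
  obtain ⟨δ₀, d, hd, hδ₀⟩ := CyclicSextic.exists_sq_eq_neg_nat_of_isTotallyComplex (Kf i₀) h2
  obtain ⟨δ, hδ, hτ⟩ := OcticCurveFourfold.exists_delta_of_mem h2 hd hδ₀ τ
  refine hodgeConjectureFor_biproduct_comp_of_orderedPrimeTower_oneMember_intrinsic (is := is) p ∅ prio (fun m _ => ?_)
    (fun m m' _ _ h => hinj h) (fun m m' _ _ h => hmono m m' h) (fun m hm => absurd hm (Finset.notMem_empty m))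
    (fun m hm => absurd hm (Finset.notMem_empty m)) (fun m hm => absurd hm (Finset.notMem_empty m)) (fun m => ?_) (fun m => ?_) κ h2 hdeg im
    (fun m₀ _ hex => ?_) hτ hA hΨ hp (fun m => ?_)
  · rcases hnp m with ⟨h, -⟩ | ⟨h, -⟩ <;> rw [h] <;> norm_num
  · rcases hnp m with ⟨-, h⟩ | ⟨-, h⟩ <;> omega
  · rcases hnp m with ⟨h, h'⟩ | ⟨h, h'⟩ <;> omega
  · obtain ⟨m, -, hne, hn, hlt⟩ := hex
    obtain ⟨ρ, hρτ, hfix, hmove⟩ := hH m₀ ⟨m, hne, hn, hlt⟩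
    exact ⟨ρ, hρτ, fun m _ hn hlt => hfix m hn hlt, hmove⟩
  · have hnp' : (n m = 3 ∧ p m = 1) ∨ (n m = 4 ∧ p m = 1) ∨ (n m = 4 ∧ p m = 2) ∨ (n m = 5 ∧ p m = 2) := by
      rcases hnp m with h | h
      · exact Or.inl h
      · exact Or.inr (Or.inr (Or.inr h))
    exact weilHyp_of_markman_intrinsic hW4 hM6 m hnp' (hdeg m) h2 hd hδ hA hΨ (hp m)

/-- **… and for every abelian variety DOMINATED by such a product** (isogeny images, abelian subvarieties, quotients). `HC_CM` is NOT asserted.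
[cite: MumfordAV1970, §19] [cite: Markman2025SurveySecant, Thm. 1.2] [cite: Markman2025SecantWeil, Thm 1.5.1] -/
theorem hodgeConjectureFor_of_avDominatedBy_comp_of_sexticDecicTower (hW4 : Markman2025_weilClasses_algebraic_abelianFourfold)
    (hM6 : Markman2025_weilClasses_algebraic_hyperbolicSixfold) (n p prio : Fin r → ℕ)
    (hnp : ∀ m, (n m = 3 ∧ p m = 1) ∨ (n m = 5 ∧ p m = 2)) (hinj : Function.Injective prio) (hmono : ∀ m m', n m < n m' → prio m < prio m')
    {N : ℕ} (κ : Fin N → Fin (r + 1)) (h2 : Module.finrank ℚ (Kf i₀) = 2) (hdeg : ∀ m : Fin r, Module.finrank ℚ (Kf (is m)) = 2 * n m)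
    (im : ∀ m : Fin r, Kf i₀ →+* Kf (is m)) (hA : ∀ j, IsCMTypeRealisation (Φ j) (A j) (ι j) (θ j)) (hΨ : ∀ σ : Kf i₀ →+* ℂ, σ ∈ (Φ 0).1 ↔ σ = τ)
    (hp : ∀ m : Fin r, (Finset.univ.filter fun s : Kf (is m) →+* ℂ => s.comp (im m) = τ ∧ s ∈ (Φ m.succ).1).card = p m)
    (hH : ∀ m₀ : Fin r, (∃ m, m ≠ m₀ ∧ n m = n m₀ ∧ prio m < prio m₀) →
      ∃ ρ : ℂ ≃+* ℂ, (ρ : ℂ →+* ℂ).comp τ = τ ∧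
        (∀ m, n m = n m₀ → prio m < prio m₀ → ∀ s : Kf (is m) →+* ℂ, s.comp (im m) = τ → (ρ : ℂ →+* ℂ).comp s = s) ∧
        ∃ s : Kf (is m₀) →+* ℂ, s.comp (im m₀) = τ ∧ (ρ : ℂ →+* ℂ).comp s ≠ s)
    {X : AbelianVariety ℂ} (hX : Domination.AVDominatedBy X (⨁ fun j => A (κ j))) : HodgeConjectureFor X.dim X.X :=
  Domination.hodgeConjectureFor_of_avDominatedBy
    (hodgeConjectureFor_biproduct_comp_of_sexticDecicTower hW4 hM6 n p prio hnp hinj hmono κ h2 hdeg im hA hΨ hp hH) hX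

/-! ## §1 Sextic fields only: Markman's fourfold theorem alone -/

/-- **HEADLINE — ANY NUMBER OF `(1,2)`-THREEFOLDS OVER SEXTIC CM FIELDS SHARING `k`, GIVEN ONLY MARKMAN'S FOURFOLD THEOREM.**  `E = A 0 ⊨ (k; {τ})`,
`T_m = A (m+1) ⊨ (K_m; Φ (m+1))` over SEXTIC `K_m ⊇ i_m(k)` with ONE member of `Φ (m+1)` over `τ`, the fields taken in the order of their index: for every `m₀` with a
predecessor, some automorphism of `ℂ` over `τ(k)` FIXES every `τ`-embedding of the `K_m`, `m < m₀`, and MOVES one of `K_{m₀}` (`hH`).  Then the Hodge conjecture holds for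
EVERY product of copies `⨁_j A(κ j)` of `E, T_0, …, T_{r−1}`.  `HC_CM` is NOT asserted. [cite: Markman2025SurveySecant, Thm. 1.2] [cite: Pohlmann1968, Thm 1]
[cite: MoonenZarhin1995Duke, Thm. 2.4] [cite: DixonMortimer1996, §1.6 and Thm. 1.6A] -/
theorem hodgeConjectureFor_biproduct_comp_of_sexticTower (hW4 : Markman2025_weilClasses_algebraic_abelianFourfold)
    {N : ℕ} (κ : Fin N → Fin (r + 1)) (h2 : Module.finrank ℚ (Kf i₀) = 2) (h6 : ∀ m : Fin r, Module.finrank ℚ (Kf (is m)) = 6)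
    (im : ∀ m : Fin r, Kf i₀ →+* Kf (is m)) (hA : ∀ j, IsCMTypeRealisation (Φ j) (A j) (ι j) (θ j)) (hΨ : ∀ σ : Kf i₀ →+* ℂ, σ ∈ (Φ 0).1 ↔ σ = τ)
    (h1 : ∀ m : Fin r, (Finset.univ.filter fun s : Kf (is m) →+* ℂ => s.comp (im m) = τ ∧ s ∈ (Φ m.succ).1).card = 1)
    (hH : ∀ m₀ : Fin r, (∃ m, m < m₀) →
      ∃ ρ : ℂ ≃+* ℂ, (ρ : ℂ →+* ℂ).comp τ = τ ∧ (∀ m, m < m₀ → ∀ s : Kf (is m) →+* ℂ, s.comp (im m) = τ → (ρ : ℂ →+* ℂ).comp s = s) ∧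
        ∃ s : Kf (is m₀) →+* ℂ, s.comp (im m₀) = τ ∧ (ρ : ℂ →+* ℂ).comp s ≠ s) :
    HodgeConjectureFor (⨁ fun j => A (κ j)).dim (⨁ fun j => A (κ j)).X := by
  obtain ⟨δ₀, d, hd, hδ₀⟩ := CyclicSextic.exists_sq_eq_neg_nat_of_isTotallyComplex (Kf i₀) h2
  obtain ⟨δ, hδ, hτ⟩ := OcticCurveFourfold.exists_delta_of_mem h2 hd hδ₀ τ
  refine hodgeConjectureFor_biproduct_comp_of_orderedPrimeTower_oneMember_intrinsic (is := is) (n := fun _ => 3) (fun _ => 1) ∅ (fun m => (m : ℕ))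
    (fun m _ => by norm_num) (fun m m' _ _ h => Fin.ext h) (fun m m' _ _ h => absurd h (lt_irrefl _)) (fun m hm => absurd hm (Finset.notMem_empty m))
    (fun m hm => absurd hm (Finset.notMem_empty m)) (fun m hm => absurd hm (Finset.notMem_empty m)) (fun _ => Nat.one_pos) (fun _ => by norm_num) κ h2
    (fun m => by rw [h6 m]) im (fun m₀ _ hex => ?_) hτ hA hΨ h1 fun m => ?_
  · obtain ⟨m, -, -, -, hlt⟩ := hex
    obtain ⟨ρ, hρτ, hfix, hmove⟩ := hH m₀ ⟨m, hlt⟩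
    exact ⟨ρ, hρτ, fun m _ _ hlt => hfix m hlt, hmove⟩
  · exact weilHyp_of_markman_fourfold_intrinsic hW4 m (h6 m) h2 hd hδ hA hΨ (h1 m)

/-! ## §2 Decic fields only: Markman's hyperbolic-sixfold theorem alone -/

/-- **HEADLINE — ANY NUMBER OF `(2,3)`-FIVEFOLDS OVER DECIC CM FIELDS SHARING `k`, GIVEN ONLY MARKMAN'S HYPERBOLIC-SIXFOLD THEOREM.**  As §1 with DECIC `K_m`
(`[K_m : ℚ] = 10`) and TWO members of `Φ (m+1)` over `τ`; the same ordered automorphism hypothesis `hH`.  `HC_CM` is NOT asserted. [cite: Markman2025SecantWeil, Thm 1.5.1]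
[cite: Pohlmann1968, Thm 1] [cite: MoonenZarhin1995Duke, Thm. 2.4] [cite: DixonMortimer1996, §1.6 and Thm. 1.6A] -/
theorem hodgeConjectureFor_biproduct_comp_of_decicTower (hM6 : Markman2025_weilClasses_algebraic_hyperbolicSixfold)
    {N : ℕ} (κ : Fin N → Fin (r + 1)) (h2 : Module.finrank ℚ (Kf i₀) = 2) (h10 : ∀ m : Fin r, Module.finrank ℚ (Kf (is m)) = 10)
    (im : ∀ m : Fin r, Kf i₀ →+* Kf (is m)) (hA : ∀ j, IsCMTypeRealisation (Φ j) (A j) (ι j) (θ j)) (hΨ : ∀ σ : Kf i₀ →+* ℂ, σ ∈ (Φ 0).1 ↔ σ = τ)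
    (h23 : ∀ m : Fin r, (Finset.univ.filter fun s : Kf (is m) →+* ℂ => s.comp (im m) = τ ∧ s ∈ (Φ m.succ).1).card = 2)
    (hH : ∀ m₀ : Fin r, (∃ m, m < m₀) →
      ∃ ρ : ℂ ≃+* ℂ, (ρ : ℂ →+* ℂ).comp τ = τ ∧ (∀ m, m < m₀ → ∀ s : Kf (is m) →+* ℂ, s.comp (im m) = τ → (ρ : ℂ →+* ℂ).comp s = s) ∧
        ∃ s : Kf (is m₀) →+* ℂ, s.comp (im m₀) = τ ∧ (ρ : ℂ →+* ℂ).comp s ≠ s) :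
    HodgeConjectureFor (⨁ fun j => A (κ j)).dim (⨁ fun j => A (κ j)).X := by
  obtain ⟨δ₀, d, hd, hδ₀⟩ := CyclicSextic.exists_sq_eq_neg_nat_of_isTotallyComplex (Kf i₀) h2
  obtain ⟨δ, hδ, hτ⟩ := OcticCurveFourfold.exists_delta_of_mem h2 hd hδ₀ τ
  refine hodgeConjectureFor_biproduct_comp_of_orderedPrimeTower_oneMember_intrinsic (is := is) (n := fun _ => 5) (fun _ => 2) ∅ (fun m => (m : ℕ))
    (fun m _ => by norm_num) (fun m m' _ _ h => Fin.ext h) (fun m m' _ _ h => absurd h (lt_irrefl _)) (fun m hm => absurd hm (Finset.notMem_empty m))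
    (fun m hm => absurd hm (Finset.notMem_empty m)) (fun m hm => absurd hm (Finset.notMem_empty m)) (fun _ => Nat.succ_pos 1) (fun _ => by norm_num) κ h2
    (fun m => by rw [h10 m]) im (fun m₀ _ hex => ?_) hτ hA hΨ h23 fun m => ?_
  · obtain ⟨m, -, -, -, hlt⟩ := hex
    obtain ⟨ρ, hρτ, hfix, hmove⟩ := hH m₀ ⟨m, hlt⟩
    exact ⟨ρ, hρτ, fun m _ _ hlt => hfix m hlt, hmove⟩
  · exact weilHyp_of_markman_sixfold_decic_intrinsic hM6 m (h10 m) h2 hd hδ hA hΨ (h23 m)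

end Summit.HodgeConjecture.CorCM.MultiFieldWeil

end
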